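import Literature.NumberTheory.EllipticCurves.PadicSigmaThreeUniversalRing
import Literature.NumberTheory.EllipticCurves.FormalMulTwoSecondCoeffProofs
import HarnessLib

/-!
# The universal ordinary `a₁`-chart at `p = 2`: the ring `R̂₂ = ℤ[B₂, B₆][1/D]^₂` (`D = B₆((1+4B₂)³ + 432B₆) = −Δ`),
# the universal chart curve `y² + xy = x³ + B₂x² + B₆`, specialisations (Blakestad–Grant Thm. 15), Frobenius
# congruences (Def. 8), and `K₂ = R̂₂[1/2]`

Topic `Literature/NumberTheory/EllipticCurves` (trunk T-NT-EC). The `p = 2` twin of the tree's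
`PadicSigmaThreeUniversalRing.lean` (itself the `p = 3` twin of Blakestad–Grant's `UniversalOrdinaryRing.lean`, `p ≥ 5`):
the base ring of a Blakestad–Grant-type proof of the existence of the Mazur–Tate sigma-SQUARED function at a good
ORDINARY `2` (tree named fact `mazurTate_sigmaSq_existsUnique_two` = Mazur–Tate 1991 Thm. 3.1 / Silverman 2005 §5
Rem. 2), following the discharge plan `Summits/BirchSwinnertonDyer/BirchSwinnertonDyer/Cruxes/BSDOfMainConjectureRankOneAtTwo/
SIGMASQ-AT-TWO-att-p3.md` (step S1) of the cell `bsd-f1-sign2` (seat `bsd-line-att-p3` g8). At `p = 2` the Hasse invariant of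
`y² + a₁xy + a₃y = …` is `a₁`, and every `2`-integral equation with `a₁ ∈ ℤ₂ˣ` is `ℤ₂`-isomorphic to a CHART curve
`y² + xy = x³ + b₂x² + b₆` with `b₆ ∈ ℤ₂ˣ` (tree `…SigmaSqTwoChart.lean`, `exists_variableChange_chart`,
`mazurTate_sigmaSq_existsUnique_two_of_forall_chart`); the universal such curve lives over the `2`-adic completion of
`ℤ[B₂, B₆][1/D]`, `D = B₆·((1 + 4B₂)³ + 432B₆)` (`Δ = −D`; `D ≡ B₆ (mod 2)` is not in `(2)`), which carries a Frobenius lift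
(Def. 8) because it is a completed localised polynomial ring.

Built EXACTLY as the `p = 3` file (same Mathlib objects, same generic completion facts
`Literature.RingTheory.AdicTopology.PrincipalCompletion`), with `(Fin 2; D)` for `(Fin 3; Y)` and `2` for `3`:
* Part ring: `coeffRing = ℤ[B₂, B₆]`, `B2v`, `B6v`, `Dv`; `(2)` prime, `D ∉ (2)`; `localizedRing = ℤ[B₂,B₆][1/D]` a domain with `(2)`
  prime and no `2`-torsion; `completeRing = R̂₂`: `IsAdicComplete (2)`, a DOMAIN, `(2)` prime, `charP_quotient`, no additive torsion,
  `2`-adically separated, `2 ≠ 0`; `univB2`, `univB6`, units `univD`, `univB6`, `(1 + 4B₂)³ + 432B₆`.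
* Part chart: `universalCurve = ⟨1, B₂, 0, 0, B₆⟩` over `R̂₂`, `Δ = −D` a unit (`isElliptic_universalCurve`), Hasse coefficient
  `w₁ = a₁ = 1` (`coeff_one_formalInvDiff_universalCurve`); `specialize b₂ b₆ (hD) : R̂₂ →+* A` into any `2`-adically complete ring
  (Thm. 15 for the chart), `ringHom_ext`, `specialize_sub_sq_mem` — if `b₂ ≡ B₂²`, `b₆ ≡ B₆² (mod 2)` then `α = specialize b₂ b₆`
  satisfies `α(x) ≡ x² (mod 2)` for ALL `x` (Def. 8; the hypothesis of the tree's Dwork lemma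
  `Literature.RingTheory.FormalGroups.coeff_mem_of_map_subst_eq_pow_mul`).
* Part `K₂ = R̂₂[1/2]` (`completeRingQ`): `intSubring`, `exists_pow_mul_mem_intSubring`, `extendQ α` with `extendQ_mem_intSubring`,
  `exists_extendQ_eq_sq_add`, `Algebra ℚ K₂`, `K₂` a domain, `exists_ringHom_completeRingQ_padic`, `norm_le_one_of_mem_intSubring`.
NOT here (plan S5′): Blakestad–Grant's Thm. 2 at `p = 2` (the even-zeta normalisation must be replaced at `2`, where the formal
inverse is not `−z`).

## Sources
* C. Blakestad, D. Grant, J. Number Theory 249 (2023) 348–376, §2.1–2.2, Lemma 5, Def. 8, Thm. 15. [cite: BlakestadGrant2023, Thm. 15]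
* B. Mazur, J. Tate, Duke Math. J. 62 (1991), Thm. 3.1; J. H. Silverman, Math. Ann. 332 (2005) §5 Rem. 2. [cite: MazurTate1991, Thm. 3.1]
* J. H. Silverman, *AEC* 2nd ed., Appendix A Prop. 1.1 (normal forms with `a₁ ≠ 0`, `j = 1/Δ`-type charts in characteristic `2`).
  [cite: SilvermanAEC2009, Appendix A Prop. 1.1]

Design notes. Definitions (all with bodies): `coeffRing`, `B2v`, `B6v`, `Dv`, `localizedRing`, `completeRing`, `univB2`, `univB6`,
`univD`, `universalCurve`, `specializeAway`, `specialize`, `completeRingQ`, `intSubring`, `extendQ`, `ratCast`; instances only on the NEW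
concrete types defined here (domain, adic completeness, torsion-freeness, `Algebra ℚ`, `IsElliptic` of the universal curve), exactly as in
the `p = 3` / `p ≥ 5` files. No named facts, no `sorry`.
-/

noncomputable section

open Polynomial

namespace Literature.NumberTheory.EllipticCurves.PadicSigmaSqTwo.Universal

open Literature.RingTheory.AdicTopology Literature.NumberTheory.EllipticCurves

/-! ## `ℤ[B₂, B₆]` -/

/-- **`ℤ[B₂, B₆]`**, the coefficient ring of the `a₁`-chart. [cite: BlakestadGrant2023, §2.1] -/
abbrev coeffRing : Type := MvPolynomial (Fin 2) ℤ

/-- The variable `B₂`. [cite: BlakestadGrant2023, §2.1] -/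
def B2v : coeffRing := MvPolynomial.X 0

/-- The variable `B₆`. [cite: BlakestadGrant2023, §2.1] -/
def B6v : coeffRing := MvPolynomial.X 1

/-- **`D = B₆·((1 + 4B₂)³ + 432B₆) = −Δ`** of the chart curve `y² + xy = x³ + B₂x² + B₆`. [cite: SilvermanAEC2009, III.1] -/
def Dv : coeffRing := B6v * ((1 + 4 * B2v) ^ 3 + 432 * B6v)

/-- The kernel of reduction `ℤ[B₂,B₆] → 𝔽_p[B₂,B₆]` is `(p)`. [cite: BlakestadGrant2023, §2.1] -/
theorem ker_map_castRingHom (p : ℕ) :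
    RingHom.ker (MvPolynomial.map (σ := Fin 2) (Int.castRingHom (ZMod p))) = Ideal.span {(p : coeffRing)} := by
  rw [MvPolynomial.ker_map, ZMod.ker_intCastRingHom, Ideal.map_span, Set.image_singleton, map_natCast]

/-- `(p)` is a prime ideal of `ℤ[B₂, B₆]`. [cite: BlakestadGrant2023, §2.1] -/
theorem span_natCast_isPrime (p : ℕ) [Fact p.Prime] : (Ideal.span {(p : coeffRing)}).IsPrime := by
  rw [← ker_map_castRingHom]
  exact RingHom.ker_isPrime _

/-- `D ≡ B₆ (mod 2)`, so `D ≢ 0 (mod 2)`. [cite: SilvermanAEC2009, Appendix A Prop. 1.1] -/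
theorem Dv_map_ne_zero : MvPolynomial.map (Int.castRingHom (ZMod 2)) Dv ≠ 0 := by
  have h4 : (Int.castRingHom (ZMod 2)) 4 = 0 := by decide
  have h432 : (Int.castRingHom (ZMod 2)) 432 = 0 := by decide
  have hD : MvPolynomial.map (Int.castRingHom (ZMod 2)) Dv = MvPolynomial.X 1 := by
    rw [Dv, B2v, B6v]
    simp only [map_mul, map_add, map_pow, map_one, MvPolynomial.map_X]
    rw [show (4 : coeffRing) = MvPolynomial.C 4 from by norm_num [map_ofNat],
      show (432 : coeffRing) = MvPolynomial.C 432 from by norm_num [map_ofNat], MvPolynomial.map_C, MvPolynomial.map_C]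
    have e4 : (Int.castRingHom (ZMod 2)) 4 = 0 := h4
    have e432 : (Int.castRingHom (ZMod 2)) 432 = 0 := h432
    rw [e4, e432, MvPolynomial.C_0, zero_mul, zero_mul, add_zero, add_zero, one_pow, mul_one]
  rw [hD]
  exact MvPolynomial.X_ne_zero _

/-- `D ≠ 0` in `ℤ[B₂, B₆]`. [cite: BlakestadGrant2023, §2.1] -/
theorem Dv_ne_zero : Dv ≠ 0 := by
  intro h
  exact Dv_map_ne_zero (by rw [h, map_zero])

/-- `D ∉ (2)`. [cite: SilvermanAEC2009, Appendix A Prop. 1.1] -/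
theorem Dv_not_mem_span : Dv ∉ Ideal.span {((2 : ℕ) : coeffRing)} := by
  rw [← ker_map_castRingHom, RingHom.mem_ker]
  exact Dv_map_ne_zero

/-- The powers of `D` avoid `(2)`. [cite: BlakestadGrant2023, §2.1] -/
theorem disjoint_powers_Dv_span :
    Disjoint (Submonoid.powers Dv : Set coeffRing) ↑(Ideal.span {((2 : ℕ) : coeffRing)}) := by
  rw [Set.disjoint_left]
  rintro x ⟨k, rfl⟩ hx
  exact Dv_not_mem_span ((span_natCast_isPrime 2).mem_of_pow_mem k hx)

/-- `p ≠ 0` in `ℤ[B₂, B₆]`. [folklore] -/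
private theorem natCast_ne_zero {p : ℕ} (hp : p ≠ 0) : (p : coeffRing) ≠ 0 := by
  rw [← map_natCast (MvPolynomial.C : ℤ →+* coeffRing), Ne, MvPolynomial.C_eq_zero, Nat.cast_eq_zero]
  exact hp

/-! ## `ℤ[B₂, B₆][1/D]` -/

/-- **`ℤ[B₂, B₆][1/D]`**. [cite: BlakestadGrant2023, §2.1] -/
abbrev localizedRing : Type := Localization.Away Dv

/-- `ℤ[B₂,B₆][1/D]` is a domain. [folklore] -/
instance isDomain_localizedRing : IsDomain localizedRing :=
  IsLocalization.isDomain_localization (powers_le_nonZeroDivisors_of_noZeroDivisors Dv_ne_zero)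

/-- `ℤ[B₂,B₆] → ℤ[B₂,B₆][1/D]` is injective. [cite: BlakestadGrant2023, §2.1] -/
theorem algebraMap_localizedRing_injective : Function.Injective (algebraMap coeffRing localizedRing) :=
  IsLocalization.injective localizedRing (powers_le_nonZeroDivisors_of_noZeroDivisors Dv_ne_zero)

/-- `(2)` is a prime ideal of `ℤ[B₂,B₆][1/D]`. [cite: BlakestadGrant2023, §2.1] -/
theorem span_two_isPrime_localizedRing : (Ideal.span {((2 : ℕ) : localizedRing)}).IsPrime := by
  have h := IsLocalization.isPrime_of_isPrime_disjoint (Submonoid.powers Dv) localizedRing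
    (Ideal.span {((2 : ℕ) : coeffRing)}) (span_natCast_isPrime 2) disjoint_powers_Dv_span
  rwa [Ideal.map_span, Set.image_singleton, map_natCast] at h

/-- `ℤ[B₂,B₆][1/D]` has no `2`-torsion. [cite: BlakestadGrant2023, §2.1] -/
theorem eq_zero_of_two_mul_eq_zero (x : localizedRing) (hx : ((2 : ℕ) : localizedRing) * x = 0) : x = 0 := by
  have hp0 : ((2 : ℕ) : localizedRing) ≠ 0 := by
    rw [← map_natCast (algebraMap coeffRing localizedRing), Ne, ← (algebraMap coeffRing localizedRing).map_zero,
      algebraMap_localizedRing_injective.eq_iff]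
    exact natCast_ne_zero two_ne_zero
  exact (mul_eq_zero.mp hx).resolve_left hp0

/-- `D` is a unit of `ℤ[B₂,B₆][1/D]`. [cite: BlakestadGrant2023, §2.1] -/
theorem isUnit_algebraMap_Dv : IsUnit (algebraMap coeffRing localizedRing Dv) :=
  IsLocalization.Away.algebraMap_isUnit Dv

/-! ## `R̂₂`, the `2`-adic completion -/

/-- **`R̂₂`, the `2`-adic completion of `ℤ[B₂, B₆][1/D]`** — the base of the universal ordinary `a₁`-chart at `p = 2`.
[cite: BlakestadGrant2023, §2.1] -/
abbrev completeRing : Type := AdicCompletion (Ideal.span {((2 : ℕ) : localizedRing)}) localizedRing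

/-- `R̂₂` is `2`-adically complete. [folklore] -/
instance isAdicComplete_completeRing : IsAdicComplete (Ideal.span {((2 : ℕ) : completeRing)}) completeRing :=
  isAdicComplete_span_natCast localizedRing 2

/-- The same instance with the literal `2`. [folklore] -/
instance isAdicComplete_completeRing' : IsAdicComplete (Ideal.span {(2 : completeRing)}) completeRing :=
  isAdicComplete_span_natCast localizedRing 2

/-- `ℤ[B₂,B₆] → R̂₂` factors through the localisation. [cite: BlakestadGrant2023, §2.1] -/
theorem algebraMap_coeffRing_apply (q : coeffRing) :
    algebraMap coeffRing completeRing q = algebraMap localizedRing completeRing (algebraMap coeffRing localizedRing q) := by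
  rw [AdicCompletion.algebraMap_apply, AdicCompletion.algebraMap_apply, Algebra.algebraMap_self, RingHom.id_apply]

/-- `B₂ ∈ R̂₂`. [cite: BlakestadGrant2023, §2.1] -/
def univB2 : completeRing := algebraMap coeffRing completeRing B2v

/-- `B₆ ∈ R̂₂`. [cite: BlakestadGrant2023, §2.1] -/
def univB6 : completeRing := algebraMap coeffRing completeRing B6v

/-- `D ∈ R̂₂`. [cite: BlakestadGrant2023, §2.1] -/
def univD : completeRing := algebraMap coeffRing completeRing Dv

/-- `D = B₆((1 + 4B₂)³ + 432B₆)` in `R̂₂`. [cite: SilvermanAEC2009, III.1] -/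
theorem univD_eq : univD = univB6 * ((1 + 4 * univB2) ^ 3 + 432 * univB6) := by
  change algebraMap coeffRing completeRing (B6v * ((1 + 4 * B2v) ^ 3 + 432 * B6v)) =
    algebraMap coeffRing completeRing B6v *
      ((1 + 4 * algebraMap coeffRing completeRing B2v) ^ 3 + 432 * algebraMap coeffRing completeRing B6v)
  simp only [map_mul, map_add, map_pow, map_one, map_ofNat]

/-- **`D` is a unit of `R̂₂`.** [cite: BlakestadGrant2023, §2.1] -/
theorem isUnit_univD : IsUnit univD := by
  rw [univD, algebraMap_coeffRing_apply]
  exact isUnit_algebraMap_Dv.map _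

/-- **`B₆` is a unit of `R̂₂`** (good reduction of the chart curve). [cite: SilvermanAEC2009, Appendix A Prop. 1.1] -/
theorem isUnit_univB6 : IsUnit univB6 := by
  have h := isUnit_univD
  rw [univD_eq] at h
  exact isUnit_of_mul_isUnit_left h

/-- `(1 + 4B₂)³ + 432B₆` is a unit of `R̂₂`. [cite: SilvermanAEC2009, Appendix A Prop. 1.1] -/
theorem isUnit_E : IsUnit ((1 + 4 * univB2) ^ 3 + 432 * univB6) := by
  have h := isUnit_univD
  rw [univD_eq] at h
  exact isUnit_of_mul_isUnit_right h

/-- `(2) ⊂ R̂₂` is prime. [cite: BlakestadGrant2023, §2.1] -/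
theorem span_two_isPrime_completeRing : (Ideal.span {(2 : completeRing)}).IsPrime := by
  haveI := span_two_isPrime_localizedRing
  have h := span_algebraMap_isPrime ((2 : ℕ) : localizedRing)
  rwa [algebraMap_natCast, Nat.cast_ofNat] at h

/-- **`R̂₂` is an integral domain.** [cite: BlakestadGrant2023, §2.2] -/
instance isDomain_completeRing : IsDomain completeRing :=
  haveI := span_two_isPrime_localizedRing
  isDomain_natCast localizedRing 2 eq_zero_of_two_mul_eq_zero

/-- `2` is not a unit of `R̂₂`. [cite: BlakestadGrant2023, §2.1] -/
theorem two_mem_nonunits : (2 : completeRing) ∈ nonunits completeRing :=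
  fun hu => span_two_isPrime_completeRing.ne_top
    (Ideal.eq_top_of_isUnit_mem _ (Ideal.mem_span_singleton_self _) hu)

/-- `R̂₂/(2)` has characteristic `2`. [cite: BlakestadGrant2023, §2.1] -/
theorem charP_quotient : CharP (completeRing ⧸ Ideal.span {(2 : completeRing)}) 2 :=
  CharP.quotient completeRing 2 two_mem_nonunits

/-- `2ᵏ x = 0 ↔ x = 0` in `R̂₂`. [cite: BlakestadGrant2023, §2.1] -/
theorem pow_mul_eq_zero_iff_completeRing (k : ℕ) (x : completeRing) : ((2 : ℕ) : completeRing) ^ k * x = 0 ↔ x = 0 :=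
  natCast_pow_mul_eq_zero_iff localizedRing 2 eq_zero_of_two_mul_eq_zero k x

/-- **`R̂₂` has no additive torsion.** [folklore] -/
instance isAddTorsionFree_completeRing : IsAddTorsionFree completeRing := by
  refine ⟨fun n hn a b hab => ?_⟩
  have h0 : (n : completeRing) * (a - b) = 0 := by
    have hab' : n • a = n • b := hab
    rw [mul_sub, ← nsmul_eq_mul, ← nsmul_eq_mul, hab', sub_self]
  obtain ⟨k, m, hm, rfl⟩ := Nat.exists_eq_pow_mul_and_not_dvd hn 2 (by norm_num)
  have hmu : IsUnit (m : completeRing) :=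
    isUnit_natCast_of_coprime (p := 2) ((Nat.Prime.coprime_iff_not_dvd Nat.prime_two).mpr hm).symm
  rw [Nat.cast_mul, Nat.cast_pow, mul_assoc, pow_mul_eq_zero_iff_completeRing,
    hmu.mul_right_eq_zero, sub_eq_zero] at h0
  exact h0

/-- `R̂₂` is `2`-adically separated: `(∀ n, c ∈ (2^{n+1})) → c = 0`. [cite: BlakestadGrant2023, §2.1] -/
theorem eq_zero_of_forall_mem_pow (c : completeRing) (h : ∀ n : ℕ, c ∈ Ideal.span {(2 : completeRing) ^ (n + 1)}) :
    c = 0 := by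
  refine IsHausdorff.haus' (I := Ideal.span {(2 : completeRing)}) c fun n => ?_
  rw [SModEq.zero, smul_eq_mul, Ideal.mul_top, Ideal.span_singleton_pow]
  rcases n with _ | n
  · rw [pow_zero, Ideal.span_singleton_one]; exact Submodule.mem_top
  · exact h n

/-- `2 ≠ 0` in `R̂₂` (the hypothesis of the tree's `velu_two_formalInvDiff_subst`). [cite: BlakestadGrant2023, §2.2 (K = R̂[1/p])] -/
theorem two_ne_zero' : (2 : completeRing) ≠ 0 := by
  intro h0
  have h1 : ((2 : ℕ) : completeRing) ^ 1 * 1 = 0 := by rw [pow_one, mul_one]; exact_mod_cast h0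
  exact one_ne_zero ((pow_mul_eq_zero_iff_completeRing 1 1).mp h1)

/-! ## The universal chart curve -/

/-- **The universal ordinary `a₁`-chart curve `𝓔 : y² + xy = x³ + B₂x² + B₆` over `R̂₂`.** [cite: SilvermanAEC2009, Appendix A Prop. 1.1] -/
def universalCurve : WeierstrassCurve completeRing := ⟨1, univB2, 0, 0, univB6⟩

/-- `a₁(𝓔) = 1`. [cite: SilvermanAEC2009, Appendix A Prop. 1.1] -/
@[simp] theorem universalCurve_a₁ : universalCurve.a₁ = 1 := rfl
/-- `a₂(𝓔) = B₂`. [cite: SilvermanAEC2009, Appendix A Prop. 1.1] -/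
@[simp] theorem universalCurve_a₂ : universalCurve.a₂ = univB2 := rfl
/-- `a₃(𝓔) = 0`. [cite: SilvermanAEC2009, Appendix A Prop. 1.1] -/
@[simp] theorem universalCurve_a₃ : universalCurve.a₃ = 0 := rfl
/-- `a₄(𝓔) = 0`. [cite: SilvermanAEC2009, Appendix A Prop. 1.1] -/
@[simp] theorem universalCurve_a₄ : universalCurve.a₄ = 0 := rfl
/-- `a₆(𝓔) = B₆`. [cite: SilvermanAEC2009, Appendix A Prop. 1.1] -/
@[simp] theorem universalCurve_a₆ : universalCurve.a₆ = univB6 := rfl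

/-- `Δ(𝓔) = −D`. [cite: SilvermanAEC2009, III.1] -/
theorem Δ_universalCurve : universalCurve.Δ = -univD := by
  rw [univD_eq]
  simp only [WeierstrassCurve.Δ, WeierstrassCurve.b₂, WeierstrassCurve.b₄, WeierstrassCurve.b₆, WeierstrassCurve.b₈,
    universalCurve_a₁, universalCurve_a₂, universalCurve_a₃, universalCurve_a₄, universalCurve_a₆]
  ring

/-- **`𝓔` is an elliptic curve over `R̂₂`** (`Δ = −D` is a unit). [cite: SilvermanAEC2009, III.1] -/
instance isElliptic_universalCurve : universalCurve.IsElliptic :=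
  ⟨by rw [Δ_universalCurve]; exact isUnit_univD.neg⟩

/-- The Hasse coefficient at `2`: `w₁ = a₁ = 1` (`[z¹]ω = a₁`), a unit. [cite: BlakestadGrant2023, Prop. 3] -/
theorem coeff_one_formalInvDiff_universalCurve : PowerSeries.coeff 1 universalCurve.formalInvDiff = 1 := by
  rw [WeierstrassCurve.coeff_one_formalInvDiff, universalCurve_a₁]

/-! ## Specialisation (Blakestad–Grant Thm 15) and endomorphisms (Def 8) -/

section Specialize

variable {A : Type*} [CommRing A] (b₂ b₆ : A) (hD : IsUnit (b₆ * ((1 + 4 * b₂) ^ 3 + 432 * b₆)))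

/-- Evaluation of `D` at `(b₂, b₆)`: `D(b₂, b₆) = b₆((1 + 4b₂)³ + 432b₆)`. [cite: BlakestadGrant2023, Thm. 15] -/
theorem eval₂Hom_Dv : MvPolynomial.eval₂Hom (Int.castRingHom A) ![b₂, b₆] Dv = b₆ * ((1 + 4 * b₂) ^ 3 + 432 * b₆) := by
  rw [Dv, B2v, B6v]
  simp only [map_mul, map_add, map_pow, map_one, map_ofNat, MvPolynomial.coe_eval₂Hom, MvPolynomial.eval₂_X]
  rfl

/-- `ℤ[B₂,B₆][1/D] → A`, `(B₂, B₆) ↦ (b₂, b₆)` when `D(b₂, b₆)` is a unit. [cite: BlakestadGrant2023, Thm. 15] -/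
def specializeAway : localizedRing →+* A :=
  IsLocalization.Away.lift Dv (g := MvPolynomial.eval₂Hom (Int.castRingHom A) ![b₂, b₆]) (by rwa [eval₂Hom_Dv])

/-- `specializeAway` on `ℤ[B₂,B₆]` is evaluation. [cite: BlakestadGrant2023, Thm. 15] -/
theorem specializeAway_algebraMap (q : coeffRing) :
    specializeAway b₂ b₆ hD (algebraMap coeffRing localizedRing q) = MvPolynomial.eval₂Hom (Int.castRingHom A) ![b₂, b₆] q :=
  IsLocalization.Away.lift_eq Dv _ q

variable [IsAdicComplete (Ideal.span {((2 : ℕ) : A)}) A]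

/-- **The specialisation `ρ : R̂₂ → A`, `(B₂, B₆) ↦ (b₂, b₆)`** into a `2`-adically complete ring (`D(b₂,b₆)` a unit, e.g.
`A = ℤ₂` and a chart curve with good reduction). [cite: BlakestadGrant2023, Thm. 15] -/
def specialize : completeRing →+* A :=
  liftNatCast localizedRing 2 (specializeAway b₂ b₆ hD)

/-- `ρ` on `ℤ[B₂,B₆]` is evaluation. [cite: BlakestadGrant2023, Thm. 15] -/
theorem specialize_algebraMap (q : coeffRing) :
    specialize b₂ b₆ hD (algebraMap coeffRing completeRing q) = MvPolynomial.eval₂Hom (Int.castRingHom A) ![b₂, b₆] q := by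
  rw [algebraMap_coeffRing_apply, specialize, liftNatCast_algebraMap, specializeAway_algebraMap]

/-- `ρ(B₂) = b₂`. [cite: BlakestadGrant2023, Thm. 15] -/
theorem specialize_univB2 : specialize b₂ b₆ hD univB2 = b₂ := by
  rw [univB2, specialize_algebraMap, B2v, MvPolynomial.coe_eval₂Hom, MvPolynomial.eval₂_X]; rfl

/-- `ρ(B₆) = b₆`. [cite: BlakestadGrant2023, Thm. 15] -/
theorem specialize_univB6 : specialize b₂ b₆ hD univB6 = b₆ := by
  rw [univB6, specialize_algebraMap, B6v, MvPolynomial.coe_eval₂Hom, MvPolynomial.eval₂_X]; rfl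

/-- `ρ` maps the universal chart curve to the chart curve `⟨1, b₂, 0, 0, b₆⟩`. [cite: BlakestadGrant2023, Thm. 15] -/
theorem universalCurve_map_specialize : universalCurve.map (specialize b₂ b₆ hD) = ⟨1, b₂, 0, 0, b₆⟩ := by
  simp only [universalCurve, WeierstrassCurve.map, map_one, map_zero]
  rw [specialize_univB2, specialize_univB6]

end Specialize

/-- **Ring maps out of `R̂₂` into a `2`-adically separated ring are determined by the images of `B₂, B₆`.**
[cite: BlakestadGrant2023, Thm. 15] -/
theorem ringHom_ext {B : Type*} [CommRing B] [IsHausdorff (Ideal.span {((2 : ℕ) : B)}) B]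
    {ψ ψ' : completeRing →+* B} (h2 : ψ univB2 = ψ' univB2) (h6 : ψ univB6 = ψ' univB6) : ψ = ψ' := by
  refine ringHom_ext_natCast (R := localizedRing) 2 fun r => ?_
  suffices hcomp : ψ.comp (algebraMap localizedRing completeRing) = ψ'.comp (algebraMap localizedRing completeRing) from
    RingHom.congr_fun hcomp r
  refine IsLocalization.ringHom_ext (Submonoid.powers Dv) ?_
  refine MvPolynomial.ringHom_ext (fun n => by simp only [eq_intCast, map_intCast]) fun i => ?_
  simp only [RingHom.comp_apply, ← algebraMap_coeffRing_apply]
  fin_cases i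
  · exact h2
  · exact h6

/-- **Frobenius congruences on `ℤ[B₂, B₆]`**: if `I ∋ p` and `b_j ≡ φ(X_j)ᵖ (mod I)` for both variables, then evaluation at `b` is
congruent to `φ(·)ᵖ` modulo `I` on all of `ℤ[B₂, B₆]`. (Verbatim from the `p = 3` file with `Fin 2`.) [cite: BlakestadGrant2023, Def. 8] -/
theorem eval₂Hom_sub_pow_mem (p : ℕ) [Fact p.Prime] {B : Type*} [CommRing B] (φ : coeffRing →+* B) (b : Fin 2 → B)
    (I : Ideal B) (hpI : (p : B) ∈ I) (hb : ∀ i, b i - φ (MvPolynomial.X i) ^ p ∈ I) (q : coeffRing) :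
    MvPolynomial.eval₂Hom (Int.castRingHom B) b q - φ q ^ p ∈ I := by
  have hp : p.Prime := Fact.out
  induction q using MvPolynomial.induction_on with
  | C r =>
    rw [MvPolynomial.coe_eval₂Hom, MvPolynomial.eval₂_C, eq_intCast, eq_intCast, map_intCast]
    have hdvd : (p : ℤ) ∣ r - r ^ p := by
      rw [← ZMod.intCast_zmod_eq_zero_iff_dvd, Int.cast_sub, Int.cast_pow, ZMod.pow_card, sub_self]
    obtain ⟨c, hc⟩ := hdvd
    have e : ((r : B) - (r : B) ^ p) = (p : B) * (c : B) := by exact_mod_cast congrArg (Int.cast (R := B)) hc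
    rw [e]
    exact I.mul_mem_right _ hpI
  | add q₁ q₂ ih₁ ih₂ =>
    obtain ⟨c, hc⟩ := exists_add_pow_prime_eq hp (φ q₁) (φ q₂)
    have e : MvPolynomial.eval₂Hom (Int.castRingHom B) b (q₁ + q₂) - φ (q₁ + q₂) ^ p =
        (MvPolynomial.eval₂Hom (Int.castRingHom B) b q₁ - φ q₁ ^ p) +
        (MvPolynomial.eval₂Hom (Int.castRingHom B) b q₂ - φ q₂ ^ p) - (p : B) * φ q₁ * φ q₂ * c := by
      rw [map_add, map_add, hc]; ring
    rw [e]
    exact sub_mem (add_mem ih₁ ih₂) (I.mul_mem_right _ (I.mul_mem_right _ (I.mul_mem_right _ hpI)))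
  | mul_X q i ih =>
    have e : MvPolynomial.eval₂Hom (Int.castRingHom B) b (q * MvPolynomial.X i) - φ (q * MvPolynomial.X i) ^ p =
        (MvPolynomial.eval₂Hom (Int.castRingHom B) b q - φ q ^ p) * b i + φ q ^ p * (b i - φ (MvPolynomial.X i) ^ p) := by
      rw [map_mul, map_mul, MvPolynomial.coe_eval₂Hom, MvPolynomial.eval₂_X, mul_pow]; ring
    rw [e]
    exact add_mem (I.mul_mem_right _ ih) (I.mul_mem_left _ (hb i))

/-- **An endomorphism `α = specialize b₂ b₆` of `R̂₂` with `b₂ ≡ B₂²`, `b₆ ≡ B₆² (mod 2)` reduces to the Frobenius: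
`α(x) ≡ x² (mod 2)` for all `x ∈ R̂₂`** (Blakestad–Grant Def. 8; the hypothesis `hα` of the tree's Dwork lemma
`Literature.RingTheory.FormalGroups.coeff_mem_of_map_subst_eq_pow_mul` at `p = 2`). [cite: BlakestadGrant2023, Def. 8] -/
theorem specialize_sub_sq_mem (b₂ b₆ : completeRing) (hD : IsUnit (b₆ * ((1 + 4 * b₂) ^ 3 + 432 * b₆)))
    (h2 : b₂ - univB2 ^ 2 ∈ Ideal.span {(2 : completeRing)}) (h6 : b₆ - univB6 ^ 2 ∈ Ideal.span {(2 : completeRing)})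
    (x : completeRing) : specialize b₂ b₆ hD x - x ^ 2 ∈ Ideal.span {(2 : completeRing)} := by
  set I := Ideal.span {(2 : completeRing)} with hI
  set f := specializeAway b₂ b₆ hD with hf
  set u := algebraMap localizedRing completeRing with hu
  have hpoly : ∀ q : coeffRing, MvPolynomial.eval₂Hom (Int.castRingHom completeRing) ![b₂, b₆] q -
      algebraMap coeffRing completeRing q ^ 2 ∈ I := by
    intro q
    refine eval₂Hom_sub_pow_mem 2 (algebraMap coeffRing completeRing) ![b₂, b₆] I
      (Ideal.mem_span_singleton_self _) (fun i => ?_) q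
    fin_cases i
    · exact h2
    · exact h6
  have hloc : ∀ z : localizedRing, f z - u z ^ 2 ∈ I := by
    intro z
    obtain ⟨⟨q, s⟩, hqs⟩ := IsLocalization.surj (Submonoid.powers Dv) z
    simp only at hqs
    have hsu : IsUnit (algebraMap coeffRing localizedRing (s : coeffRing)) := IsLocalization.map_units localizedRing s
    have hunit : IsUnit (f (algebraMap coeffRing localizedRing s)) := hsu.map f
    have hc : f (algebraMap coeffRing localizedRing q) - u (algebraMap coeffRing localizedRing q) ^ 2 ∈ I := by
      rw [hf, specializeAway_algebraMap, hu, ← algebraMap_coeffRing_apply]; exact hpoly q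
    have hs : f (algebraMap coeffRing localizedRing s) - u (algebraMap coeffRing localizedRing s) ^ 2 ∈ I := by
      rw [hf, specializeAway_algebraMap, hu, ← algebraMap_coeffRing_apply]; exact hpoly s
    have e : (f z - u z ^ 2) * f (algebraMap coeffRing localizedRing s) =
        (f (algebraMap coeffRing localizedRing q) - u (algebraMap coeffRing localizedRing q) ^ 2) +
          u z ^ 2 * (u (algebraMap coeffRing localizedRing s) ^ 2 - f (algebraMap coeffRing localizedRing s)) := by
      have h1 : f z * f (algebraMap coeffRing localizedRing s) = f (algebraMap coeffRing localizedRing q) := by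
        rw [← map_mul, hqs]
      have h2' : u z ^ 2 * u (algebraMap coeffRing localizedRing s) ^ 2 = u (algebraMap coeffRing localizedRing q) ^ 2 := by
        rw [← mul_pow, ← map_mul, hqs]
      rw [sub_mul, h1, ← h2']; ring
    rw [← Ideal.mul_unit_mem_iff_mem I hunit, e]
    exact add_mem hc (I.mul_mem_left _ (by rw [← neg_sub]; exact I.neg_mem hs))
  have h := sub_pow_mem_span_of_forall_algebraMap ((2 : ℕ) : localizedRing) 2 (specialize b₂ b₆ hD) ?_ ?_ x
  · rw [algebraMap_natCast] at h
    exact h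
  · rw [algebraMap_natCast, map_natCast]; exact Ideal.mem_span_singleton_self _
  · intro z
    rw [algebraMap_natCast, specialize, liftNatCast_algebraMap]
    exact hloc z

/-! ## `K₂ = R̂₂[1/2]` -/

/-- **`K₂ = R̂₂[1/2]`**. [cite: BlakestadGrant2023, §2.2] -/
abbrev completeRingQ : Type := Localization.Away (2 : completeRing)

/-- `2` is a unit of `K₂`. [cite: BlakestadGrant2023, §2.2 (K = R̂[1/p])] -/
theorem isUnit_two_completeRingQ : IsUnit (2 : completeRingQ) := by
  have h := IsLocalization.Away.algebraMap_isUnit (S := completeRingQ) (2 : completeRing)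
  rwa [map_ofNat] at h

/-- **`R̂₂ ⊆ K₂`** (the range of `R̂₂ → K₂`). [cite: BlakestadGrant2023, §2.2] -/
abbrev intSubring : Subring completeRingQ := (algebraMap completeRing completeRingQ).range

/-- `K₂ = R̂₂[1/2]`: every element becomes integral after multiplication by a power of `2`. [cite: BlakestadGrant2023, §2.2 (K = R̂[1/p])] -/
theorem exists_pow_mul_mem_intSubring (x : completeRingQ) : ∃ k : ℕ, (2 : completeRingQ) ^ k * x ∈ intSubring := by
  obtain ⟨⟨r, s⟩, h⟩ := IsLocalization.surj (Submonoid.powers (2 : completeRing)) x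
  obtain ⟨k, hk⟩ := s.2
  refine ⟨k, r, ?_⟩
  simp only at h
  rw [mul_comm, ← h, ← hk, map_pow, map_ofNat]

/-- The same with `((2 : ℕ) : K₂)` (the form of the tree's Dwork lemma). [cite: BlakestadGrant2023, §2.2 (K = R̂[1/p])] -/
theorem exists_natCast_pow_mul_mem_intSubring (x : completeRingQ) :
    ∃ k : ℕ, ((2 : ℕ) : completeRingQ) ^ k * x ∈ intSubring :=
  exists_pow_mul_mem_intSubring x

section Extend

variable (α : completeRing →+* completeRing)

/-- A ring endomorphism of `R̂₂` preserves the powers of `2`. [folklore] -/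
private theorem powers_le_comap : Submonoid.powers (2 : completeRing) ≤ (Submonoid.powers (2 : completeRing)).comap α := by
  rw [Submonoid.powers_le, Submonoid.mem_comap, map_ofNat]
  exact Submonoid.mem_powers _

/-- **The extension `α_K : K₂ → K₂`** of an endomorphism `α` of `R̂₂`. [cite: BlakestadGrant2023, Lemma 5] -/
def extendQ : completeRingQ →+* completeRingQ :=
  IsLocalization.map completeRingQ α (powers_le_comap α)

/-- `α_K` restricted to `R̂₂` is `α`. [cite: BlakestadGrant2023, Def. 8] -/
theorem extendQ_algebraMap (x : completeRing) :
    extendQ α (algebraMap completeRing completeRingQ x) = algebraMap completeRing completeRingQ (α x) :=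
  IsLocalization.map_eq (powers_le_comap α) x

/-- `α_K(R̂₂) ⊆ R̂₂`. [cite: BlakestadGrant2023, Def. 8] -/
theorem extendQ_mem_intSubring {r : completeRingQ} (hr : r ∈ intSubring) : extendQ α r ∈ intSubring := by
  obtain ⟨x, rfl⟩ := hr
  exact ⟨α x, (extendQ_algebraMap α x).symm⟩

/-- If `α ≡` Frobenius `(mod 2)` on `R̂₂`, then `α_K(r) = r² + 2·a` with `a ∈ R̂₂` for `r ∈ R̂₂`. [cite: BlakestadGrant2023, Def. 8] -/
theorem exists_extendQ_eq_sq_add (hα : ∀ x, α x - x ^ 2 ∈ Ideal.span {(2 : completeRing)})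
    {r : completeRingQ} (hr : r ∈ intSubring) :
    ∃ a ∈ intSubring, extendQ α r = r ^ 2 + 2 * a := by
  obtain ⟨x, rfl⟩ := hr
  obtain ⟨y, hy⟩ := Ideal.mem_span_singleton.mp (hα x)
  refine ⟨algebraMap _ _ y, ⟨y, rfl⟩, ?_⟩
  rw [extendQ_algebraMap, eq_add_of_sub_eq hy, map_add, map_mul, map_pow, map_ofNat, add_comm]

/-- The same in the `((2 : ℕ) : K₂)`-form of the tree's Dwork lemma. [cite: BlakestadGrant2023, Def. 8] -/
theorem exists_extendQ_eq_sq_add' (hα : ∀ x, α x - x ^ 2 ∈ Ideal.span {(2 : completeRing)})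
    {r : completeRingQ} (hr : r ∈ intSubring) :
    ∃ a ∈ intSubring, extendQ α r = r ^ (2 : ℕ) + ((2 : ℕ) : completeRingQ) * a :=
  exists_extendQ_eq_sq_add α hα hr

end Extend

/-- Every nonzero natural number is a unit of `K₂`. [cite: BlakestadGrant2023, §2.2 (K = R̂[1/p])] -/
theorem isUnit_natCast_completeRingQ {n : ℕ} (hn : n ≠ 0) : IsUnit (n : completeRingQ) := by
  obtain ⟨k, m, hm, rfl⟩ := Nat.exists_eq_pow_mul_and_not_dvd hn 2 (by norm_num)
  rw [Nat.cast_mul, Nat.cast_pow]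
  refine ((isUnit_two_completeRingQ).pow k).mul ?_
  have hmu : IsUnit (m : completeRing) :=
    isUnit_natCast_of_coprime (p := 2) ((Nat.Prime.coprime_iff_not_dvd Nat.prime_two).mpr hm).symm
  simpa using hmu.map (algebraMap completeRing completeRingQ)

/-- Every nonzero integer is a unit of `K₂`. [cite: BlakestadGrant2023, §2.2 (K = R̂[1/p])] -/
theorem isUnit_intCast_completeRingQ {n : ℤ} (hn : n ≠ 0) : IsUnit (n : completeRingQ) := by
  have h : ((n.sign : ℤ) : completeRingQ) * (n : completeRingQ) = (n.natAbs : ℕ) := by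
    rw [← Int.cast_mul, Int.sign_mul_self_eq_natAbs, Int.cast_natCast]
  have hu : IsUnit (((n.sign : ℤ) : completeRingQ) * (n : completeRingQ)) := by
    rw [h]
    exact isUnit_natCast_completeRingQ (Int.natAbs_ne_zero.mpr hn)
  exact isUnit_of_mul_isUnit_right hu

/-- The ring map `ℚ → K₂`. [folklore] -/
def ratCast : ℚ →+* completeRingQ :=
  IsLocalization.lift (M := nonZeroDivisors ℤ) (S := ℚ) (g := Int.castRingHom completeRingQ)
    fun y => isUnit_intCast_completeRingQ (mem_nonZeroDivisors_iff_ne_zero.mp y.2)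

/-- **`K₂` is a `ℚ`-algebra.** [folklore] -/
instance algebraRat_completeRingQ : Algebra ℚ completeRingQ := ratCast.toAlgebra

/-- **`R̂₂ → K₂` is injective.** [cite: BlakestadGrant2023, Thm. 15] -/
theorem algebraMap_completeRingQ_injective : Function.Injective (algebraMap completeRing completeRingQ) :=
  IsLocalization.injective completeRingQ (powers_le_nonZeroDivisors_of_noZeroDivisors two_ne_zero')

/-- `K₂` is an integral domain (the hypothesis of the tree's `velu_two_formalLog_subst`). [folklore] -/
instance isDomain_completeRingQ : IsDomain completeRingQ :=
  IsLocalization.isDomain_localization (powers_le_nonZeroDivisors_of_noZeroDivisors two_ne_zero')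

/-- `R̂₂ → K₂` is injective on power series. [cite: BlakestadGrant2023, Thm. 15] -/
theorem powerSeries_map_algebraMap_injective :
    Function.Injective (PowerSeries.map (algebraMap completeRing completeRingQ)) :=
  PowerSeries.map_injective _ algebraMap_completeRingQ_injective

/-- **`ρ` extends to `K₂`**: a ring map `ρ : R̂₂ → ℤ₂` induces `ρ_K : K₂ → ℚ₂` with `ρ_K|_{R̂₂} = ρ`. [cite: BlakestadGrant2023, Thm. 15] -/
theorem exists_ringHom_completeRingQ_padic (ρ : completeRing →+* ℤ_[2]) :
    ∃ ρK : completeRingQ →+* ℚ_[2], ∀ x, ρK (algebraMap completeRing completeRingQ x) = ((ρ x : ℤ_[2]) : ℚ_[2]) := by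
  have hu : IsUnit (((PadicInt.Coe.ringHom (p := 2)).comp ρ) (2 : completeRing)) := by
    rw [map_ofNat]
    exact isUnit_iff_ne_zero.mpr (by norm_num)
  refine ⟨IsLocalization.Away.lift (2 : completeRing) hu, fun x => ?_⟩
  rw [IsLocalization.Away.lift_eq]
  rfl

/-- Coefficients in `R̂₂ ⊆ K₂` specialise to `2`-integral elements of `ℚ₂`. [cite: BlakestadGrant2023, Thm. 15] -/
theorem norm_le_one_of_mem_intSubring {ρ : completeRing →+* ℤ_[2]} {ρK : completeRingQ →+* ℚ_[2]}
    (hρK : ∀ x, ρK (algebraMap completeRing completeRingQ x) = ((ρ x : ℤ_[2]) : ℚ_[2]))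
    {c : completeRingQ} (hc : c ∈ intSubring) : ‖ρK c‖ ≤ 1 := by
  obtain ⟨x, rfl⟩ := hc
  rw [hρK, ← PadicInt.norm_def]
  exact PadicInt.norm_le_one _

end Literature.NumberTheory.EllipticCurves.PadicSigmaSqTwo.Universal
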